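import Literature.MathematicalPhysics.QuantumLattice.HubbardNNNHoppingClusterEmbedding
import Literature.MathematicalPhysics.QuantumLattice.HubbardNNNHoppingOpenClusters
import Literature.MathematicalPhysics.QuantumLattice.HubbardTorusPlaquetteDressedBound
import HarnessLib

/-!
# Anderson cluster lower bounds for the `t–t'` Hubbard torus: the cluster-embedding step

Topic `MathematicalPhysics/QuantumLattice`, family `hubbard`. Part II of the cluster-embedding
machinery (Part I: `HubbardNNNHoppingClusterEmbedding.lean`). Anderson's (1951) lower bound for a
lattice Hamiltonian `H = Σ_C h_C` written as a sum of (overlapping) cluster Hamiltonians — "each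
summand is bounded below by its own lowest eigenvalue, hence `E₀(H) ≥ Σ_C λ_min(h_C)`" [Anderson 1951,
eq. (2)], in the form used for the square-lattice Hubbard model by Valentí–Stolze–Hirschfeld (1991)
§II — made literal for the rectangular `t–t'` torus `hubbardRectTorusTT' a b t t' U`
(`HubbardNNNHopping.lean`; LeBlanc et al. 2015 eq. (1)) covered by ALL `a·b` translates of an open
`r × c` box (`hubbardOpenBoxTT' r c`, `HubbardNNNHoppingOpenClusters.lean`):

* `boxTranslate hr hc g : Fin r ×ₗ Fin c ↪ Fin a ×ₗ Fin b`, `p ↦ g + p` — the translate of the box by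
  the torus site `g` (`r ≤ a`, `c ≤ b`);
* `sum_fermionEmbed_boxTranslate_openBox` — **the cover identity**: summing the embedded box
  Hamiltonian over all translates counts every nearest-neighbour bond of the torus
  `(r-1)c` times (horizontal) resp. `r(c-1)` times (vertical), every diagonal bond `(r-1)(c-1)` times
  and every site `rc` times (in terms of the directed hoppings `hopDir` of Part I);
* `sum_fermionEmbed_boxTranslate_openBox_symm` — adding the transposed `c × r` boxes equalises the two
  bond directions: `Σ_g [Γ(ι_g) h_{r×c} + Γ(ι'_g) h_{c×r}] = hubbardRectTorusTT' a b (w_nn t₁) (w_d t₁') (w_s U₁)`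
  with the covering multiplicities `w_nn = (r-1)c + (c-1)r`, `w_d = 2(r-1)(c-1)`, `w_s = 2rc`;
  `sum_fermionEmbed_boxTranslate_openBox_sq` — for a square `s × s` box one orientation suffices
  (`w_nn = s(s-1)`, `w_d = (s-1)²`, `w_s = s²`);
* `sum_fermionEmbed_boxTranslate_totalNumber` — `Σ_g Γ(ι_g) N̂_box = (rc) · N̂`;
* **the bound** `groundEnergy_hubbardRectTorusTT'_ge_of_openBox_symm` /
  `groundEnergy_hubbardRectTorusTT'_ge_of_openBox_sq`: if `h_box + μ N̂_box ≥ m` on the whole box Fock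
  space (for instance `m = min_k (σ_k + μ k)` with certified sector floors `σ_k`), then
  `n_C · m - μ · w_s · N ≤ E₀(hubbardRectTorusTT' a b (w_nn t₁) (w_d t₁') (w_s U₁), N)`,
  `n_C = 2ab` (resp. `ab`), for every `N ≤ 2ab` and `a, b ≥ 3` — exactly the "residual meta step"
  (cluster embedding + sector minimum) of the cell's `anderson-cluster-lower-v1` certificates.

References: Anderson, Phys. Rev. 83 (1951) 1260, eq. (2) [cite: Anderson1951, eq. (2)];
Valentí–Stolze–Hirschfeld, Phys. Rev. B 43 (1991) 13743, §II [cite: ValentiStolzeHirschfeld1991, §II];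
LeBlanc et al., PRX 5 (2015) 041041, eq. (1) [cite: LeBlancEtAl2015, eq. (1)]; Lieb,
arXiv:cond-mat/9311033 §2 (sectors) [cite: arXiv9311033, §2]. Everything is proved; the one new
definition has a body; no named facts. Counting lemmas are file-private plumbing.
-/

noncomputable section

namespace Literature.MathematicalPhysics.QuantumLattice

open Matrix Finset HubbardWave0
open scoped ComplexOrder

namespace ClusterLowerBound

variable {a b r c : ℕ}

/-! ### §1. Translates of a box inside the torus -/

/-- Coordinates of a translate (first). [folklore] -/
private theorem shiftPt_fst (d₁ d₂ : ℕ) (x : Fin a ×ₗ Fin b) :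
    (((ofLex (shiftPt d₁ d₂ x)).1 : Fin a) : ℕ) = (((ofLex x).1 : ℕ) + d₁) % a := rfl

/-- Coordinates of a translate (second). [folklore] -/
private theorem shiftPt_snd (d₁ d₂ : ℕ) (x : Fin a ×ₗ Fin b) :
    (((ofLex (shiftPt d₁ d₂ x)).2 : Fin b) : ℕ) = (((ofLex x).2 : ℕ) + d₂) % b := rfl

/-- Two torus sites are equal iff their coordinates are. [folklore] -/
private theorem site_eq_iff (x y : Fin a ×ₗ Fin b) :
    x = y ↔ ((ofLex x).1 : ℕ) = (ofLex y).1 ∧ ((ofLex x).2 : ℕ) = (ofLex y).2 := by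
  constructor
  · rintro rfl; exact ⟨rfl, rfl⟩
  · rintro ⟨h1, h2⟩
    exact ofLex.injective (Prod.ext (Fin.ext h1) (Fin.ext h2))

/-- A full period is the identity translation. [folklore] -/
private theorem shiftPt_period (x : Fin a ×ₗ Fin b) : shiftPt a b x = x := by
  rw [site_eq_iff, shiftPt_fst, shiftPt_snd, Nat.add_mod_right, Nat.add_mod_right,
    Nat.mod_eq_of_lt (ofLex x).1.isLt, Nat.mod_eq_of_lt (ofLex x).2.isLt]
  exact ⟨rfl, rfl⟩

/-- **The translate by `g` of the open `r × c` box** inside the torus `ℤ/aℤ × ℤ/bℤ` (`r ≤ a`, `c ≤ b`):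
`p ↦ g + p` on representatives. These `a·b` charts are the clusters of Anderson's bound.
[cite: Anderson1951, eq. (2)] -/
def boxTranslate (hr : r ≤ a) (hc : c ≤ b) (g : Fin a ×ₗ Fin b) : Fin r ×ₗ Fin c ↪ Fin a ×ₗ Fin b :=
  ⟨fun p => shiftPt ((ofLex p).1 : ℕ) ((ofLex p).2 : ℕ) g, by
    intro p q h
    rw [site_eq_iff, shiftPt_fst, shiftPt_fst, shiftPt_snd, shiftPt_snd] at h
    have hp1 := (ofLex p).1.isLt; have hq1 := (ofLex q).1.isLt
    have hp2 := (ofLex p).2.isLt; have hq2 := (ofLex q).2.isLt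
    have e1 : ((ofLex p).1 : ℕ) = (ofLex q).1 :=
      Nat.ModEq.eq_of_lt_of_lt (Nat.ModEq.add_left_cancel' _ h.1) (by omega) (by omega)
    have e2 : ((ofLex p).2 : ℕ) = (ofLex q).2 :=
      Nat.ModEq.eq_of_lt_of_lt (Nat.ModEq.add_left_cancel' _ h.2) (by omega) (by omega)
    exact ofLex.injective (Prod.ext (Fin.ext e1) (Fin.ext e2))⟩

/-- `boxTranslate` unfolded. [folklore] -/
@[simp] private theorem boxTranslate_apply (hr : r ≤ a) (hc : c ≤ b) (g : Fin a ×ₗ Fin b) (p : Fin r ×ₗ Fin c) :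
    boxTranslate hr hc g p = shiftPt ((ofLex p).1 : ℕ) ((ofLex p).2 : ℕ) g := rfl

/-- **Pair re-indexing**: summing a two-point function over all translates of a pair `(p, q)` of box
sites gives the translation-summed two-point function at the lattice vector `q - p`.
[cite: Anderson1951, eq. (2)] -/
private theorem sum_boxTranslate_pair {M : Type*} [AddCommMonoid M] (hr : r ≤ a) (hc : c ≤ b)
    (p q : Fin r ×ₗ Fin c) (F : Fin a ×ₗ Fin b → Fin a ×ₗ Fin b → M) :
    ∑ g, F (boxTranslate hr hc g p) (boxTranslate hr hc g q) =
      ∑ x, F x (shiftPt ((a - (ofLex p).1) + (ofLex q).1) ((b - (ofLex p).2) + (ofLex q).2) x) := by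
  rw [← sum_shiftPt (a - (ofLex p).1) (b - (ofLex p).2)
    (fun g => F (boxTranslate hr hc g p) (boxTranslate hr hc g q))]
  refine Finset.sum_congr rfl fun x _ => ?_
  have hp1 := (ofLex p).1.isLt; have hp2 := (ofLex p).2.isLt
  simp only [boxTranslate_apply, shiftPt_shiftPt]
  rw [Nat.sub_add_cancel (by omega : ((ofLex p).1 : ℕ) ≤ a), Nat.sub_add_cancel (by omega : ((ofLex p).2 : ℕ) ≤ b),
    shiftPt_period]

/-- Sums over `Fin r ×ₗ Fin c` as double sums over the coordinates. [folklore] -/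
private theorem sum_lex {M : Type*} [AddCommMonoid M] (f : Fin r ×ₗ Fin c → M) :
    ∑ p, f p = ∑ i : Fin r, ∑ j : Fin c, f (toLex (i, j)) := by
  rw [← (toLex : Fin r × Fin c ≃ Fin r ×ₗ Fin c).sum_comp, Fintype.sum_prod_type]

/-! ### §2. The embedded box Hamiltonian summed over translates -/

/-- **Translates of an embedded box Hamiltonian, summed**: for any bond graph `G` on the box,
`Σ_g Γ(ι_g) H_G(t,U) = -t Σ_{p ~ q in G} T_{q-p} + U · (rc) · Σ_x n_{x↑}n_{x↓}` with `T_d` the directed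
hopping `hopDir` of the torus. [cite: Anderson1951, eq. (2)] -/
private theorem sum_fermionEmbed_boxTranslate_hamiltonian (hr : r ≤ a) (hc : c ≤ b)
    (G : SimpleGraph (Fin r ×ₗ Fin c)) [DecidableRel G.Adj] (t U : ℝ) :
    ∑ g, fermionEmbed (boxTranslate hr hc g) (hamiltonian G t U) =
      -(t : ℂ) • (∑ p : Fin r ×ₗ Fin c, ∑ q : Fin r ×ₗ Fin c,
          if G.Adj p q then hopDir a b ((a - (ofLex p).1) + (ofLex q).1) ((b - (ofLex p).2) + (ofLex q).2) else 0) +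
        (U : ℂ) • (((r * c : ℕ) : ℂ) • ∑ x : Fin a ×ₗ Fin b, numberOp x 0 * numberOp x 1) := by
  simp_rw [PlaquetteLUC.fermionEmbed_hamiltonian]
  rw [Finset.sum_add_distrib, ← Finset.smul_sum, ← Finset.smul_sum]
  congr 2
  · -- hopping: move the sum over translates inside and re-index each pair
    rw [Finset.sum_comm]
    refine Finset.sum_congr rfl fun p _ => ?_
    rw [Finset.sum_comm]
    refine Finset.sum_congr rfl fun q _ => ?_
    by_cases hpq : G.Adj p q
    · simp only [if_pos hpq]
      rw [hopDir, sum_boxTranslate_pair hr hc p q (fun x y => ∑ σ : Fin 2, creation (orb x σ) * annihilation (orb y σ))]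
    · simp only [if_neg hpq, Finset.sum_const_zero]
  · -- on-site repulsion: every site is covered `rc` times
    rw [Finset.sum_comm]
    have h : ∀ p : Fin r ×ₗ Fin c, (∑ g : Fin a ×ₗ Fin b,
        numberOp (boxTranslate hr hc g p) 0 * numberOp (boxTranslate hr hc g p) 1) =
        ∑ x : Fin a ×ₗ Fin b, numberOp x 0 * numberOp x 1 := fun p =>
      sum_boxTranslate_pair hr hc p p (fun x _ => numberOp x 0 * numberOp x 1)
    simp_rw [h]
    rw [Finset.sum_const, Finset.card_univ, card_rectSites, ← Nat.cast_smul_eq_nsmul ℂ]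

/-- **Translates of the embedded box number operator, summed**: `Σ_g Γ(ι_g) N̂_box = (rc) · N̂`.
[cite: Anderson1951, eq. (2)] -/
theorem sum_fermionEmbed_boxTranslate_totalNumber (hr : r ≤ a) (hc : c ≤ b) :
    ∑ g, fermionEmbed (boxTranslate hr hc g) (totalNumber : Matrix (Finset (Orb (Fin r ×ₗ Fin c))) _ ℂ) =
      ((r * c : ℕ) : ℂ) • (totalNumber : Matrix (Finset (Orb (Fin a ×ₗ Fin b))) _ ℂ) := by
  unfold totalNumber
  simp_rw [fermionEmbed_sum, fermionEmbed_numberOp]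
  rw [Finset.sum_comm]
  have h : ∀ p : Fin r ×ₗ Fin c, (∑ g : Fin a ×ₗ Fin b, ∑ σ : Fin 2, numberOp (boxTranslate hr hc g p) σ) =
      ∑ x : Fin a ×ₗ Fin b, ∑ σ : Fin 2, numberOp x σ := fun p =>
    sum_boxTranslate_pair hr hc p p (fun x _ => ∑ σ : Fin 2, numberOp x σ)
  simp_rw [h]
  rw [Finset.sum_const, Finset.card_univ, card_rectSites, ← Nat.cast_smul_eq_nsmul ℂ]

/-! ### §3. Counting the box bonds by direction -/

section Counting

variable {M : Type*} [AddCommMonoid M] [Module ℂ M]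

omit [Module ℂ M] in
/-- `Σ_x (if P then f x else 0) = if P then Σ_x f x else 0` for a constant condition. [folklore] -/
private theorem sum_ite_const_prop {ι : Type*} (s : Finset ι) (P : Prop) [Decidable P] (f : ι → M) :
    (∑ x ∈ s, if P then f x else 0) = if P then ∑ x ∈ s, f x else 0 := by
  split_ifs <;> simp

omit [Module ℂ M] in
/-- In `[0, n)` the successor of `i` exists iff `i + 1 < n`. [folklore] -/
private theorem sum_ite_succ_eq {n : ℕ} (i : Fin n) (X : M) :
    (∑ i' : Fin n, if (i : ℕ) + 1 = (i' : ℕ) then X else 0) = if (i : ℕ) + 1 < n then X else 0 := by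
  by_cases h : (i : ℕ) + 1 < n
  · rw [if_pos h, Finset.sum_eq_single ⟨(i : ℕ) + 1, h⟩ (fun i' _ hne => if_neg fun heq => hne (Fin.ext heq.symm))
      (fun hnot => absurd (Finset.mem_univ _) hnot), if_pos rfl]
  · rw [if_neg h]
    refine Finset.sum_eq_zero fun i' _ => if_neg fun heq => h ?_
    have := i'.isLt; omega

/-- **Number of ordered successor pairs in `[0, n)`**: `#{(i, i') : i' = i + 1} = n - 1`. [folklore] -/
private theorem sum_sum_ite_succ {n : ℕ} (X : M) :
    (∑ i : Fin n, ∑ i' : Fin n, if (i : ℕ) + 1 = (i' : ℕ) then X else 0) = ((n - 1 : ℕ) : ℂ) • X := by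
  simp_rw [sum_ite_succ_eq]
  cases n with
  | zero => simp
  | succ n =>
    rw [Fin.sum_univ_castSucc]
    simp only [Fin.val_castSucc, Fin.val_last, add_lt_add_iff_right, Fin.is_lt, ↓reduceIte,
      lt_self_iff_false, add_zero, Finset.sum_const, Finset.card_univ, Fintype.card_fin,
      Nat.add_sub_cancel]
    exact (Nat.cast_smul_eq_nsmul ℂ n X).symm

/-- The same count with the roles of the two indices exchanged. [folklore] -/
private theorem sum_sum_ite_pred {n : ℕ} (X : M) :
    (∑ i : Fin n, ∑ i' : Fin n, if (i' : ℕ) + 1 = (i : ℕ) then X else 0) = ((n - 1 : ℕ) : ℂ) • X := by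
  rw [Finset.sum_comm]; exact sum_sum_ite_succ X

/-- `Σ_{j,j'} [j = j'] X = c · X`. [folklore] -/
private theorem sum_sum_ite_eq {n : ℕ} (X : M) :
    (∑ j : Fin n, ∑ j' : Fin n, if j = j' then X else 0) = ((n : ℕ) : ℂ) • X := by
  simp_rw [Finset.sum_ite_eq, if_pos (Finset.mem_univ _)]
  rw [Finset.sum_const, Finset.card_univ, Fintype.card_fin, Nat.cast_smul_eq_nsmul]

omit [Module ℂ M] in
/-- A four-fold indicator sum that factorises: first pair of indices constrained by `A`, second by
`B`. [folklore] -/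
private theorem sum4_ite_and {n m : ℕ} (A : Fin n → Fin n → Prop) [DecidableRel A]
    (B : Fin m → Fin m → Prop) [DecidableRel B] (X : M) :
    (∑ i : Fin n, ∑ j : Fin m, ∑ i' : Fin n, ∑ j' : Fin m, if A i i' ∧ B j j' then X else 0) =
      ∑ i : Fin n, ∑ i' : Fin n, if A i i' then (∑ j : Fin m, ∑ j' : Fin m, if B j j' then X else 0) else 0 := by
  refine Finset.sum_congr rfl fun i _ => ?_
  rw [Finset.sum_comm]
  refine Finset.sum_congr rfl fun i' _ => ?_
  simp_rw [ite_and, sum_ite_const_prop]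

end Counting

variable [NeZero a] [NeZero b]

/-- Open-box adjacency in coordinates. [folklore] -/
private theorem rectBoxGraph_adj_toLex (i i' : Fin r) (j j' : Fin c) :
    (rectBoxGraph r c).Adj (toLex (i, j)) (toLex (i', j')) ↔
      (j = j' ∧ ((i : ℕ) + 1 = i' ∨ (i' : ℕ) + 1 = i)) ∨ (i = i' ∧ ((j : ℕ) + 1 = j' ∨ (j' : ℕ) + 1 = j)) :=
  Iff.rfl

/-- Open-box diagonal adjacency in coordinates. [folklore] -/
private theorem rectBoxDiagGraph_adj_toLex (i i' : Fin r) (j j' : Fin c) :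
    (rectBoxDiagGraph r c).Adj (toLex (i, j)) (toLex (i', j')) ↔
      ((i : ℕ) + 1 = i' ∨ (i' : ℕ) + 1 = i) ∧ ((j : ℕ) + 1 = j' ∨ (j' : ℕ) + 1 = j) :=
  Iff.rfl

omit [NeZero a] [NeZero b] in
/-- **The nearest-neighbour box bonds, one by one**: the pair `(p, q)` of box sites is a bond iff it
is one of the four unit steps, and then the translation-summed hopping is the directed hopping
`T_{±e₁}`, `T_{±e₂}` of the torus. [cite: Anderson1951, eq. (2)] -/
private theorem ite_rectBoxGraph_adj_hopDir (hr : r ≤ a) (hc : c ≤ b) (i i' : Fin r) (j j' : Fin c) :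
    (if (rectBoxGraph r c).Adj (toLex (i, j)) (toLex (i', j')) then
        hopDir a b ((a - (i : ℕ)) + (i' : ℕ)) ((b - (j : ℕ)) + (j' : ℕ)) else 0) =
      (if (i : ℕ) + 1 = i' ∧ j = j' then hopDir a b 1 0 else 0) +
        (if (i' : ℕ) + 1 = i ∧ j = j' then hopDir a b (a - 1) 0 else 0) +
        (if i = i' ∧ (j : ℕ) + 1 = j' then hopDir a b 0 1 else 0) +
        (if i = i' ∧ (j' : ℕ) + 1 = j then hopDir a b 0 (b - 1) else 0) := by
  have hi := i.isLt; have hi' := i'.isLt; have hj := j.isLt; have hj' := j'.isLt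
  by_cases hA : (rectBoxGraph r c).Adj (toLex (i, j)) (toLex (i', j'))
  · rw [if_pos hA]
    rw [rectBoxGraph_adj_toLex] at hA
    rcases hA with ⟨hjj, h1 | h1⟩ | ⟨hii, h1 | h1⟩
    · have n2 : ¬((i' : ℕ) + 1 = i ∧ j = j') := fun h => by omega
      have n3 : ¬(i = i' ∧ (j : ℕ) + 1 = j') := fun h => by have := congrArg Fin.val h.1; omega
      have n4 : ¬(i = i' ∧ (j' : ℕ) + 1 = j) := fun h => by have := congrArg Fin.val h.1; omega
      rw [if_pos ⟨h1, hjj⟩, if_neg n2, if_neg n3, if_neg n4, add_zero, add_zero, add_zero]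
      subst hjj
      rw [show a - (i : ℕ) + (i' : ℕ) = 1 + a by omega, show b - (j : ℕ) + (j : ℕ) = 0 + b by omega,
        hopDir_add_period_fst, hopDir_add_period_snd]
    · have n1 : ¬((i : ℕ) + 1 = i' ∧ j = j') := fun h => by omega
      have n3 : ¬(i = i' ∧ (j : ℕ) + 1 = j') := fun h => by have := congrArg Fin.val h.1; omega
      have n4 : ¬(i = i' ∧ (j' : ℕ) + 1 = j) := fun h => by have := congrArg Fin.val h.1; omega
      rw [if_neg n1, if_pos ⟨h1, hjj⟩, if_neg n3, if_neg n4, zero_add, add_zero, add_zero]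
      subst hjj
      rw [show a - (i : ℕ) + (i' : ℕ) = a - 1 by omega, show b - (j : ℕ) + (j : ℕ) = 0 + b by omega,
        hopDir_add_period_snd]
    · have n1 : ¬((i : ℕ) + 1 = i' ∧ j = j') := fun h => by have := congrArg Fin.val hii; omega
      have n2 : ¬((i' : ℕ) + 1 = i ∧ j = j') := fun h => by have := congrArg Fin.val hii; omega
      have n4 : ¬(i = i' ∧ (j' : ℕ) + 1 = j) := fun h => by omega
      rw [if_neg n1, if_neg n2, if_pos ⟨hii, h1⟩, if_neg n4, zero_add, zero_add, add_zero]
      subst hii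
      rw [show a - (i : ℕ) + (i : ℕ) = 0 + a by omega, show b - (j : ℕ) + (j' : ℕ) = 1 + b by omega,
        hopDir_add_period_fst, hopDir_add_period_snd]
    · have n1 : ¬((i : ℕ) + 1 = i' ∧ j = j') := fun h => by have := congrArg Fin.val hii; omega
      have n2 : ¬((i' : ℕ) + 1 = i ∧ j = j') := fun h => by have := congrArg Fin.val hii; omega
      have n3 : ¬(i = i' ∧ (j : ℕ) + 1 = j') := fun h => by omega
      rw [if_neg n1, if_neg n2, if_neg n3, if_pos ⟨hii, h1⟩, zero_add, zero_add, zero_add]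
      subst hii
      rw [show a - (i : ℕ) + (i : ℕ) = 0 + a by omega, show b - (j : ℕ) + (j' : ℕ) = b - 1 by omega,
        hopDir_add_period_fst]
  · rw [if_neg hA]
    rw [rectBoxGraph_adj_toLex] at hA
    rw [if_neg (fun h => hA (Or.inl ⟨h.2, Or.inl h.1⟩)), if_neg (fun h => hA (Or.inl ⟨h.2, Or.inr h.1⟩)),
      if_neg (fun h => hA (Or.inr ⟨h.1, Or.inl h.2⟩)), if_neg (fun h => hA (Or.inr ⟨h.1, Or.inr h.2⟩)),
      add_zero, add_zero, add_zero]

omit [NeZero a] [NeZero b] in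
/-- **The diagonal box bonds, one by one**: the four diagonal steps and the directed hoppings
`T_{±e₁ ± e₂}`. [cite: Anderson1951, eq. (2)] -/
private theorem ite_rectBoxDiagGraph_adj_hopDir (hr : r ≤ a) (hc : c ≤ b) (i i' : Fin r) (j j' : Fin c) :
    (if (rectBoxDiagGraph r c).Adj (toLex (i, j)) (toLex (i', j')) then
        hopDir a b ((a - (i : ℕ)) + (i' : ℕ)) ((b - (j : ℕ)) + (j' : ℕ)) else 0) =
      (if (i : ℕ) + 1 = i' ∧ (j : ℕ) + 1 = j' then hopDir a b 1 1 else 0) +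
        (if (i : ℕ) + 1 = i' ∧ (j' : ℕ) + 1 = j then hopDir a b 1 (b - 1) else 0) +
        (if (i' : ℕ) + 1 = i ∧ (j : ℕ) + 1 = j' then hopDir a b (a - 1) 1 else 0) +
        (if (i' : ℕ) + 1 = i ∧ (j' : ℕ) + 1 = j then hopDir a b (a - 1) (b - 1) else 0) := by
  have hi := i.isLt; have hi' := i'.isLt; have hj := j.isLt; have hj' := j'.isLt
  by_cases hA : (rectBoxDiagGraph r c).Adj (toLex (i, j)) (toLex (i', j'))
  · rw [if_pos hA]
    rw [rectBoxDiagGraph_adj_toLex] at hA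
    rcases hA with ⟨h1 | h1, h2 | h2⟩
    · rw [if_pos ⟨h1, h2⟩, if_neg (fun h => by omega), if_neg (fun h => by omega), if_neg (fun h => by omega),
        add_zero, add_zero, add_zero,
        show a - (i : ℕ) + (i' : ℕ) = 1 + a by omega, show b - (j : ℕ) + (j' : ℕ) = 1 + b by omega,
        hopDir_add_period_fst, hopDir_add_period_snd]
    · rw [if_neg (fun h => by omega), if_pos ⟨h1, h2⟩, if_neg (fun h => by omega), if_neg (fun h => by omega),
        zero_add, add_zero, add_zero,
        show a - (i : ℕ) + (i' : ℕ) = 1 + a by omega, show b - (j : ℕ) + (j' : ℕ) = b - 1 by omega,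
        hopDir_add_period_fst]
    · rw [if_neg (fun h => by omega), if_neg (fun h => by omega), if_pos ⟨h1, h2⟩, if_neg (fun h => by omega),
        zero_add, zero_add, add_zero,
        show a - (i : ℕ) + (i' : ℕ) = a - 1 by omega, show b - (j : ℕ) + (j' : ℕ) = 1 + b by omega,
        hopDir_add_period_snd]
    · rw [if_neg (fun h => by omega), if_neg (fun h => by omega), if_neg (fun h => by omega), if_pos ⟨h1, h2⟩,
        zero_add, zero_add, zero_add,
        show a - (i : ℕ) + (i' : ℕ) = a - 1 by omega, show b - (j : ℕ) + (j' : ℕ) = b - 1 by omega]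
  · rw [if_neg hA]
    rw [rectBoxDiagGraph_adj_toLex] at hA
    rw [if_neg (fun h => hA ⟨Or.inl h.1, Or.inl h.2⟩), if_neg (fun h => hA ⟨Or.inl h.1, Or.inr h.2⟩),
      if_neg (fun h => hA ⟨Or.inr h.1, Or.inl h.2⟩), if_neg (fun h => hA ⟨Or.inr h.1, Or.inr h.2⟩),
      add_zero, add_zero, add_zero]

omit [NeZero a] [NeZero b] in
/-- **Bond count, nearest neighbours**: summed over the ordered bonds of the open `r × c` box, the
translation-summed hoppings are `(r-1)c · (T_{e₁} + T_{-e₁}) + r(c-1) · (T_{e₂} + T_{-e₂})`.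
[cite: Anderson1951, eq. (2)] -/
private theorem sum_ite_rectBoxGraph_adj_hopDir (hr : r ≤ a) (hc : c ≤ b) :
    (∑ p : Fin r ×ₗ Fin c, ∑ q : Fin r ×ₗ Fin c,
        if (rectBoxGraph r c).Adj p q then
          hopDir a b ((a - (ofLex p).1) + (ofLex q).1) ((b - (ofLex p).2) + (ofLex q).2) else 0) =
      (((r - 1) * c : ℕ) : ℂ) • (hopDir a b 1 0 + hopDir a b (a - 1) 0) +
        ((r * (c - 1) : ℕ) : ℂ) • (hopDir a b 0 1 + hopDir a b 0 (b - 1)) := by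
  rw [sum_lex]
  simp_rw [sum_lex (fun q => if (rectBoxGraph r c).Adj _ q then _ else (0 : Matrix _ _ ℂ)), ofLex_toLex]
  simp_rw [ite_rectBoxGraph_adj_hopDir hr hc]
  simp only [Finset.sum_add_distrib]
  rw [sum4_ite_and, sum4_ite_and, sum4_ite_and, sum4_ite_and]
  simp_rw [sum_sum_ite_eq, sum_sum_ite_succ, sum_sum_ite_pred]
  simp only [smul_smul, smul_add, Nat.cast_mul, add_assoc]

omit [NeZero a] [NeZero b] in
/-- **Bond count, diagonals**: `(r-1)(c-1) · (T_{e₁+e₂} + T_{e₁-e₂} + T_{-e₁+e₂} + T_{-e₁-e₂})`.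
[cite: Anderson1951, eq. (2)] -/
private theorem sum_ite_rectBoxDiagGraph_adj_hopDir (hr : r ≤ a) (hc : c ≤ b) :
    (∑ p : Fin r ×ₗ Fin c, ∑ q : Fin r ×ₗ Fin c,
        if (rectBoxDiagGraph r c).Adj p q then
          hopDir a b ((a - (ofLex p).1) + (ofLex q).1) ((b - (ofLex p).2) + (ofLex q).2) else 0) =
      (((r - 1) * (c - 1) : ℕ) : ℂ) •
        (hopDir a b 1 1 + hopDir a b 1 (b - 1) + hopDir a b (a - 1) 1 + hopDir a b (a - 1) (b - 1)) := by
  rw [sum_lex]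
  simp_rw [sum_lex (fun q => if (rectBoxDiagGraph r c).Adj _ q then _ else (0 : Matrix _ _ ℂ)), ofLex_toLex]
  simp_rw [ite_rectBoxDiagGraph_adj_hopDir hr hc]
  simp only [Finset.sum_add_distrib]
  rw [sum4_ite_and, sum4_ite_and, sum4_ite_and, sum4_ite_and]
  simp_rw [sum_sum_ite_succ, sum_sum_ite_pred]
  simp only [smul_smul, smul_add, Nat.cast_mul, add_assoc]

/-! ### §4. The cover identities -/

omit [NeZero a] [NeZero b] in
/-- **Cover identity for one box orientation**: summing the embedded open-box `t–t'` Hamiltonian over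
all `a·b` translates of the `r × c` box counts the horizontal torus bonds `(r-1)c` times, the vertical
ones `r(c-1)` times, the diagonal ones `(r-1)(c-1)` times and every site `rc` times.
[cite: Anderson1951, eq. (2)] [cite: ValentiStolzeHirschfeld1991, §II] -/
theorem sum_fermionEmbed_boxTranslate_openBox (hr : r ≤ a) (hc : c ≤ b) (t₁ t₁' U₁ : ℝ) :
    ∑ g, fermionEmbed (boxTranslate hr hc g) (hubbardOpenBoxTT' r c t₁ t₁' U₁) =
      -(t₁ : ℂ) • ((((r - 1) * c : ℕ) : ℂ) • (hopDir a b 1 0 + hopDir a b (a - 1) 0) +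
          ((r * (c - 1) : ℕ) : ℂ) • (hopDir a b 0 1 + hopDir a b 0 (b - 1))) +
        -(t₁' : ℂ) • ((((r - 1) * (c - 1) : ℕ) : ℂ) •
          (hopDir a b 1 1 + hopDir a b 1 (b - 1) + hopDir a b (a - 1) 1 + hopDir a b (a - 1) (b - 1))) +
        (U₁ : ℂ) • (((r * c : ℕ) : ℂ) • ∑ x : Fin a ×ₗ Fin b, numberOp x 0 * numberOp x 1) := by
  unfold hubbardOpenBoxTT'
  simp_rw [fermionEmbed_add]
  rw [Finset.sum_add_distrib, sum_fermionEmbed_boxTranslate_hamiltonian hr hc,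
    sum_fermionEmbed_boxTranslate_hamiltonian hr hc, sum_ite_rectBoxGraph_adj_hopDir hr hc,
    sum_ite_rectBoxDiagGraph_adj_hopDir hr hc, Complex.ofReal_zero, zero_smul, add_zero, add_right_comm]

omit [NeZero a] [NeZero b] in
/-- **Cover identity, box and transposed box** (`a, b ≥ 3`; `r, c ≤ min a b`): with the covering
multiplicities `w_nn = (r-1)c + (c-1)r`, `w_d = 2(r-1)(c-1)`, `w_s = 2rc`,
`Σ_g [Γ(ι_g) h_{r×c}(t₁,t₁',U₁) + Γ(ι'_g) h_{c×r}(t₁,t₁',U₁)] = H^{tt'}_{a×b}(w_nn t₁, w_d t₁', w_s U₁)`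
— the decomposition `H = Σ_C h_C` behind the cluster lower bound. [cite: Anderson1951, eq. (2)]
[cite: ValentiStolzeHirschfeld1991, §II] -/
theorem sum_fermionEmbed_boxTranslate_openBox_symm (ha : 3 ≤ a) (hb : 3 ≤ b) (hr : r ≤ a) (hc : c ≤ b)
    (hc' : c ≤ a) (hr' : r ≤ b) (t₁ t₁' U₁ : ℝ) :
    ∑ g, (fermionEmbed (boxTranslate hr hc g) (hubbardOpenBoxTT' r c t₁ t₁' U₁) +
        fermionEmbed (boxTranslate hc' hr' g) (hubbardOpenBoxTT' c r t₁ t₁' U₁)) =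
      hubbardRectTorusTT' a b ((((r - 1) * c + (c - 1) * r : ℕ) : ℝ) * t₁)
        (((2 * ((r - 1) * (c - 1)) : ℕ) : ℝ) * t₁') (((2 * (r * c) : ℕ) : ℝ) * U₁) := by
  rw [Finset.sum_add_distrib, sum_fermionEmbed_boxTranslate_openBox, sum_fermionEmbed_boxTranslate_openBox,
    hubbardRectTorusTT', hamiltonian_fermionRectTorusGraph_eq_hopDir ha hb,
    hamiltonian_fermionRectTorusDiagGraph_eq_hopDir ha hb]
  push_cast
  module

omit [NeZero a] [NeZero b] in
/-- **Cover identity for a square `s × s` box** (one orientation suffices: `w_nn = s(s-1)`,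
`w_d = (s-1)²`, `w_s = s²`; the `2 × 2` plaquette gives `2, 1, 4`). [cite: Anderson1951, eq. (2)]
[cite: ValentiStolzeHirschfeld1991, §II] -/
theorem sum_fermionEmbed_boxTranslate_openBox_sq {s : ℕ} (ha : 3 ≤ a) (hb : 3 ≤ b) (hs : s ≤ a) (hs' : s ≤ b)
    (t₁ t₁' U₁ : ℝ) :
    ∑ g, fermionEmbed (boxTranslate hs hs' g) (hubbardOpenBoxTT' s s t₁ t₁' U₁) =
      hubbardRectTorusTT' a b ((((s - 1) * s : ℕ) : ℝ) * t₁)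
        ((((s - 1) * (s - 1) : ℕ) : ℝ) * t₁') (((s * s : ℕ) : ℝ) * U₁) := by
  rw [sum_fermionEmbed_boxTranslate_openBox, hubbardRectTorusTT', hamiltonian_fermionRectTorusGraph_eq_hopDir ha hb,
    hamiltonian_fermionRectTorusDiagGraph_eq_hopDir ha hb, show s * (s - 1) = (s - 1) * s from Nat.mul_comm _ _]
  push_cast
  module

/-! ### §5. The cluster lower bound -/

omit [NeZero a] [NeZero b] in
/-- A finite sum of positive semidefinite matrices is positive semidefinite. [folklore] -/
private theorem posSemidef_sum {ι n : Type*} [Fintype n] (S : Finset ι) (f : ι → Matrix n n ℂ)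
    (h : ∀ i ∈ S, (f i).PosSemidef) : (∑ i ∈ S, f i).PosSemidef := by
  classical
  induction S using Finset.induction_on with
  | empty => rw [Finset.sum_empty]; exact Matrix.PosSemidef.zero
  | @insert i S hi ih =>
    rw [Finset.sum_insert hi]
    exact (h i (Finset.mem_insert_self i S)).add (ih fun j hj => h j (Finset.mem_insert_of_mem hj))

omit [NeZero a] [NeZero b] in
/-- From an operator inequality `H + κ N̂ - C ⪰ 0` on the torus Fock space to a sector bound
`C - κ N ≤ E₀(H, N)` (`N̂ = N` on the sector). [cite: arXiv9311033, §2] -/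
private theorem groundEnergy_ge_of_posSemidef_add_smul_totalNumber
    (H : Matrix (Finset (Orb (Fin a ×ₗ Fin b))) (Finset (Orb (Fin a ×ₗ Fin b))) ℂ) (κ C : ℝ)
    (hpos : (H + (κ : ℂ) • totalNumber - (C : ℂ) • 1).PosSemidef) {N : ℕ} (hN : N ≤ 2 * (a * b)) :
    C - κ * N ≤ groundEnergy H N := by
  have hN' : N ≤ Fintype.card (Orb (Fin a ×ₗ Fin b)) := by rw [card_orb, card_rectSites]; exact hN
  refine le_groundEnergy_of_posSemidef_sub_sector hN'
    (K := (-(κ : ℂ)) • ((totalNumber : Matrix (Finset (Orb (Fin a ×ₗ Fin b))) _ ℂ) - (N : ℂ) • 1))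
    (fun ψ hψ => ?_) ?_
  · rw [smul_mulVec, sub_mulVec, totalNumber_mulVec_of_isNParticle hψ, smul_mulVec, one_mulVec,
      sub_self, smul_zero, dotProduct_zero]
  · convert hpos using 1
    push_cast
    module

omit [NeZero a] [NeZero b] in
/-- **Anderson's cluster lower bound for the rectangular `t–t'` torus, box + transposed box.**
Let `a, b ≥ 3`, `r, c ≤ min a b`, and suppose the open-box Hamiltonian shifted by a chemical
potential is bounded below on the WHOLE box Fock space, `h_{r×c}(t₁,t₁',U₁) + μ N̂ ≥ m` and
`h_{c×r}(t₁,t₁',U₁) + μ N̂ ≥ m` (e.g. `m = min_k (σ_k + μ k)` with certified sector floors `σ_k`). Then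
for every `N ≤ 2ab`,
`2ab · m - μ · (2rc) · N ≤ E₀(H^{tt'}_{a×b}(w_nn t₁, w_d t₁', w_s U₁), N)`,
`w_nn = (r-1)c + (c-1)r`, `w_d = 2(r-1)(c-1)`, `w_s = 2rc`: sum the `2ab` positive operators
`Γ(ι_g)(h + μN̂ - m)` and use the cover identities. Anderson (1951) eq. (2); Valentí–Stolze–Hirschfeld
(1991) §II. [cite: Anderson1951, eq. (2)] [cite: ValentiStolzeHirschfeld1991, §II] -/
theorem groundEnergy_hubbardRectTorusTT'_ge_of_openBox_symm (ha : 3 ≤ a) (hb : 3 ≤ b) (hr : r ≤ a)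
    (hc : c ≤ b) (hc' : c ≤ a) (hr' : r ≤ b) (t₁ t₁' U₁ μ m : ℝ)
    (hm : (hubbardOpenBoxTT' r c t₁ t₁' U₁ + (μ : ℂ) • totalNumber - (m : ℂ) • 1).PosSemidef)
    (hm' : (hubbardOpenBoxTT' c r t₁ t₁' U₁ + (μ : ℂ) • totalNumber - (m : ℂ) • 1).PosSemidef)
    {N : ℕ} (hN : N ≤ 2 * (a * b)) :
    (2 * (a * b) : ℕ) * m - μ * (2 * (r * c) : ℕ) * N ≤
      groundEnergy (hubbardRectTorusTT' a b ((((r - 1) * c + (c - 1) * r : ℕ) : ℝ) * t₁)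
        (((2 * ((r - 1) * (c - 1)) : ℕ) : ℝ) * t₁') (((2 * (r * c) : ℕ) : ℝ) * U₁)) N := by
  have hpos := posSemidef_sum univ (fun g : Fin a ×ₗ Fin b =>
      fermionEmbed (boxTranslate hr hc g) (hubbardOpenBoxTT' r c t₁ t₁' U₁ + (μ : ℂ) • totalNumber - (m : ℂ) • 1) +
        fermionEmbed (boxTranslate hc' hr' g) (hubbardOpenBoxTT' c r t₁ t₁' U₁ + (μ : ℂ) • totalNumber - (m : ℂ) • 1))
    (fun g _ => (posSemidef_fermionEmbed _ hm).add (posSemidef_fermionEmbed _ hm'))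
  have hsum : ∑ g : Fin a ×ₗ Fin b,
      (fermionEmbed (boxTranslate hr hc g) (hubbardOpenBoxTT' r c t₁ t₁' U₁ + (μ : ℂ) • totalNumber - (m : ℂ) • 1) +
        fermionEmbed (boxTranslate hc' hr' g) (hubbardOpenBoxTT' c r t₁ t₁' U₁ + (μ : ℂ) • totalNumber - (m : ℂ) • 1)) =
      hubbardRectTorusTT' a b ((((r - 1) * c + (c - 1) * r : ℕ) : ℝ) * t₁)
          (((2 * ((r - 1) * (c - 1)) : ℕ) : ℝ) * t₁') (((2 * (r * c) : ℕ) : ℝ) * U₁) +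
        ((μ * (2 * (r * c) : ℕ) : ℝ) : ℂ) • totalNumber - (((2 * (a * b) : ℕ) * m : ℝ) : ℂ) • 1 := by
    simp_rw [fermionEmbed_sub, fermionEmbed_add, fermionEmbed_smul, fermionEmbed_one]
    rw [← sum_fermionEmbed_boxTranslate_openBox_symm ha hb hr hc hc' hr' t₁ t₁' U₁]
    simp only [Finset.sum_add_distrib, Finset.sum_sub_distrib, ← Finset.smul_sum,
      sum_fermionEmbed_boxTranslate_totalNumber, Finset.sum_const, Finset.card_univ, card_rectSites]
    rw [← Nat.cast_smul_eq_nsmul ℂ (a * b)]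
    push_cast
    module
  rw [hsum] at hpos
  have h := groundEnergy_ge_of_posSemidef_add_smul_totalNumber _ _ _ hpos hN
  push_cast at h ⊢
  linarith

omit [NeZero a] [NeZero b] in
/-- **Anderson's cluster lower bound for the rectangular `t–t'` torus, square `s × s` box**
(one orientation; `w_nn = s(s-1)`, `w_d = (s-1)²`, `w_s = s²`, `ab` clusters):
`ab · m - μ · s² · N ≤ E₀(H^{tt'}_{a×b}(s(s-1) t₁, (s-1)² t₁', s² U₁), N)` whenever
`h_{s×s}(t₁,t₁',U₁) + μ N̂ ≥ m` on the box Fock space. [cite: Anderson1951, eq. (2)]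
[cite: ValentiStolzeHirschfeld1991, §II] -/
theorem groundEnergy_hubbardRectTorusTT'_ge_of_openBox_sq {s : ℕ} (ha : 3 ≤ a) (hb : 3 ≤ b) (hs : s ≤ a)
    (hs' : s ≤ b) (t₁ t₁' U₁ μ m : ℝ)
    (hm : (hubbardOpenBoxTT' s s t₁ t₁' U₁ + (μ : ℂ) • totalNumber - (m : ℂ) • 1).PosSemidef)
    {N : ℕ} (hN : N ≤ 2 * (a * b)) :
    (a * b : ℕ) * m - μ * (s * s : ℕ) * N ≤
      groundEnergy (hubbardRectTorusTT' a b ((((s - 1) * s : ℕ) : ℝ) * t₁)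
        ((((s - 1) * (s - 1) : ℕ) : ℝ) * t₁') (((s * s : ℕ) : ℝ) * U₁)) N := by
  have hpos := posSemidef_sum univ (fun g : Fin a ×ₗ Fin b =>
      fermionEmbed (boxTranslate hs hs' g) (hubbardOpenBoxTT' s s t₁ t₁' U₁ + (μ : ℂ) • totalNumber - (m : ℂ) • 1))
    (fun g _ => posSemidef_fermionEmbed _ hm)
  have hsum : ∑ g : Fin a ×ₗ Fin b,
      fermionEmbed (boxTranslate hs hs' g) (hubbardOpenBoxTT' s s t₁ t₁' U₁ + (μ : ℂ) • totalNumber - (m : ℂ) • 1) =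
      hubbardRectTorusTT' a b ((((s - 1) * s : ℕ) : ℝ) * t₁)
          ((((s - 1) * (s - 1) : ℕ) : ℝ) * t₁') (((s * s : ℕ) : ℝ) * U₁) +
        ((μ * (s * s : ℕ) : ℝ) : ℂ) • totalNumber - (((a * b : ℕ) * m : ℝ) : ℂ) • 1 := by
    simp_rw [fermionEmbed_sub, fermionEmbed_add, fermionEmbed_smul, fermionEmbed_one]
    rw [← sum_fermionEmbed_boxTranslate_openBox_sq ha hb hs hs' t₁ t₁' U₁]
    simp only [Finset.sum_add_distrib, Finset.sum_sub_distrib, ← Finset.smul_sum,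
      sum_fermionEmbed_boxTranslate_totalNumber, Finset.sum_const, Finset.card_univ, card_rectSites]
    rw [← Nat.cast_smul_eq_nsmul ℂ (a * b)]
    push_cast
    module
  rw [hsum] at hpos
  have h := groundEnergy_ge_of_posSemidef_add_smul_totalNumber _ _ _ hpos hN
  push_cast at h ⊢
  linarith

omit [NeZero a] [NeZero b] in
/-- A Hermitian operator plus a real multiple of `N̂` is Hermitian. [folklore] -/
private theorem isHermitian_add_smul_totalNumber {Λ : Type*} [LinearOrder Λ] [Fintype Λ]
    {H : Matrix (Finset (Orb Λ)) (Finset (Orb Λ)) ℂ} (hH : H.IsHermitian) (μ : ℝ) :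
    (H + (μ : ℂ) • (totalNumber : Matrix (Finset (Orb Λ)) _ ℂ)).IsHermitian := by
  refine hH.add ?_
  have hN : (totalNumber : Matrix (Finset (Orb Λ)) _ ℂ).IsHermitian := by
    rw [← totalNumberOp_eq_totalNumber, totalNumberOp_eq_diagonal]
    exact Matrix.isHermitian_diagonal_of_self_adjoint _ (funext fun s => by simp)
  unfold Matrix.IsHermitian
  rw [conjTranspose_smul, hN.eq, Complex.star_def, Complex.conj_ofReal]

omit [NeZero a] [NeZero b] in
/-- **Sector floors ⇒ the operator hypothesis** of the cluster bound: if `m ≤ E₀(h_{r×c} + μN̂, k)` for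
every particle number `k ≤ 2rc` of the box, then `h_{r×c} + μN̂ - m ⪰ 0` on the box Fock space
(`posSemidef_sub_smul_one_of_forall_le_groundEnergy` of Part I). [cite: arXiv9311033, §2] -/
theorem posSemidef_openBox_add_smul_totalNumber_of_forall_le_groundEnergy (t₁ t₁' U₁ μ m : ℝ)
    (hm : ∀ k ≤ 2 * (r * c), m ≤ groundEnergy (hubbardOpenBoxTT' r c t₁ t₁' U₁ + (μ : ℂ) • totalNumber) k) :
    (hubbardOpenBoxTT' r c t₁ t₁' U₁ + (μ : ℂ) • totalNumber - (m : ℂ) • 1).PosSemidef := by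
  refine posSemidef_sub_smul_one_of_forall_le_groundEnergy
    (isHermitian_add_smul_totalNumber (hubbardOpenBoxTT'_isHermitian r c t₁ t₁' U₁) μ)
    ((hubbardOpenBoxTT'_commute_totalNumber r c t₁ t₁' U₁).add_left ((Commute.refl _).smul_left _)) ?_
  intro k hk
  rw [card_rectSites] at hk
  exact hm k hk

omit [NeZero a] [NeZero b] in
/-- Sector floors shifted by a chemical potential: `m ≤ E₀(H, k) + μ k ⇒ m ≤ E₀(H + μ N̂, k)`
(`N̂ = k` on the sector). [cite: arXiv9311033, §2] -/
private theorem le_groundEnergy_add_smul_totalNumber {Λ : Type*} [LinearOrder Λ] [Fintype Λ]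
    (H : Matrix (Finset (Orb Λ)) (Finset (Orb Λ)) ℂ) (μ m : ℝ) {k : ℕ} (hk : k ≤ 2 * Fintype.card Λ)
    (h : m ≤ groundEnergy H k + μ * k) :
    m ≤ groundEnergy (H + (μ : ℂ) • (totalNumber : Matrix (Finset (Orb Λ)) _ ℂ)) k := by
  have hk' : k ≤ Fintype.card (Orb Λ) := by rw [card_orb]; exact hk
  unfold groundEnergy
  refine le_csInf (ThermodynamicLimit.groundEnergySet_nonempty _ hk') ?_
  rintro E ⟨ψ, hψN, hψ1, rfl⟩
  have h1 := ThermodynamicLimit.groundEnergy_le_re_expect H hψN hψ1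
  have h2 : (expect (H + (μ : ℂ) • (totalNumber : Matrix (Finset (Orb Λ)) _ ℂ)) ψ).re =
      (expect H ψ).re + μ * k := by
    unfold expect
    rw [add_mulVec, smul_mulVec, totalNumber_mulVec_of_isNParticle hψN, dotProduct_add, dotProduct_smul,
      dotProduct_smul, hψ1, Complex.add_re, smul_eq_mul, smul_eq_mul, mul_one,
      show ((k : ℕ) : ℂ) = ((k : ℝ) : ℂ) by norm_cast, ← Complex.ofReal_mul, Complex.ofReal_re]
  rw [h2]
  linarith

omit [NeZero a] [NeZero b] in
/-- **The cluster lower bound in certificate form** (box `r × c` and its transpose, `2 ≤ r, c ≤ min a b`,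
`a, b ≥ 3`): with the covering multiplicities `w_nn = (r-1)c + (c-1)r`, `w_d = 2(r-1)(c-1)`, `w_s = 2rc`
and the cluster Hamiltonian `h_C = hubbardOpenBoxTT' r c (t/w_nn) (t'/w_d) (U/w_s)` (so that the `2ab`
translated copies of `h_C` and of its transpose sum to `hubbardRectTorusTT' a b t t' U`), certified
SECTOR floors `m ≤ E₀(h_C, k) + μ k` for every particle number `k ≤ 2rc` of the cluster (both
orientations) give `2ab · m - μ · 2rc · N ≤ E₀(hubbardRectTorusTT' a b t t' U, N)` for every `N ≤ 2ab`.
This is the `anderson-cluster-lower-v1` inequality `E₀(a,b,N) ≥ n_C · min_k(σ_k + μk) - μ w_s N`.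
[cite: Anderson1951, eq. (2)] [cite: ValentiStolzeHirschfeld1991, §II] -/
theorem groundEnergy_hubbardRectTorusTT'_ge_of_openBox_sectors (ha : 3 ≤ a) (hb : 3 ≤ b) (hr : r ≤ a)
    (hc : c ≤ b) (hc' : c ≤ a) (hr' : r ≤ b) (h2r : 2 ≤ r) (h2c : 2 ≤ c) (t t' U μ m : ℝ)
    (hσ : ∀ k ≤ 2 * (r * c), m ≤ groundEnergy (hubbardOpenBoxTT' r c
        (t / (((r - 1) * c + (c - 1) * r : ℕ) : ℝ)) (t' / ((2 * ((r - 1) * (c - 1)) : ℕ) : ℝ))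
        (U / ((2 * (r * c) : ℕ) : ℝ))) k + μ * k)
    (hσ' : ∀ k ≤ 2 * (c * r), m ≤ groundEnergy (hubbardOpenBoxTT' c r
        (t / (((r - 1) * c + (c - 1) * r : ℕ) : ℝ)) (t' / ((2 * ((r - 1) * (c - 1)) : ℕ) : ℝ))
        (U / ((2 * (r * c) : ℕ) : ℝ))) k + μ * k)
    {N : ℕ} (hN : N ≤ 2 * (a * b)) :
    (2 * (a * b) : ℕ) * m - μ * (2 * (r * c) : ℕ) * N ≤ groundEnergy (hubbardRectTorusTT' a b t t' U) N := by
  have hw1 : (((r - 1) * c + (c - 1) * r : ℕ) : ℝ) ≠ 0 := by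
    have : 0 < (r - 1) * c := Nat.mul_pos (by omega) (by omega)
    exact_mod_cast (by omega : (r - 1) * c + (c - 1) * r ≠ 0)
  have hw2 : (((2 * ((r - 1) * (c - 1))) : ℕ) : ℝ) ≠ 0 := by
    have : 0 < (r - 1) * (c - 1) := Nat.mul_pos (by omega) (by omega)
    exact_mod_cast (by omega : 2 * ((r - 1) * (c - 1)) ≠ 0)
  have hw3 : (((2 * (r * c)) : ℕ) : ℝ) ≠ 0 := by
    have : 0 < r * c := Nat.mul_pos (by omega) (by omega)
    exact_mod_cast (by omega : 2 * (r * c) ≠ 0)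
  have hm := posSemidef_openBox_add_smul_totalNumber_of_forall_le_groundEnergy (r := r) (c := c) _ _ _ μ m
    (fun k hk => le_groundEnergy_add_smul_totalNumber _ μ m (by rw [card_rectSites]; exact hk) (hσ k hk))
  have hm' := posSemidef_openBox_add_smul_totalNumber_of_forall_le_groundEnergy (r := c) (c := r) _ _ _ μ m
    (fun k hk => le_groundEnergy_add_smul_totalNumber _ μ m (by rw [card_rectSites]; exact hk) (hσ' k hk))
  have h := groundEnergy_hubbardRectTorusTT'_ge_of_openBox_symm ha hb hr hc hc' hr' _ _ _ μ m hm hm' hN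
  have e1 : (((r - 1) * c + (c - 1) * r : ℕ) : ℝ) * (t / (((r - 1) * c + (c - 1) * r : ℕ) : ℝ)) = t := by
    field_simp
  have e2 : (((2 * ((r - 1) * (c - 1))) : ℕ) : ℝ) * (t' / ((2 * ((r - 1) * (c - 1)) : ℕ) : ℝ)) = t' := by
    field_simp
  have e3 : (((2 * (r * c)) : ℕ) : ℝ) * (U / ((2 * (r * c) : ℕ) : ℝ)) = U := by
    field_simp
  rwa [e1, e2, e3] at h

omit [NeZero a] [NeZero b] in
/-- **The cluster lower bound in certificate form, square `s × s` box** (`2 ≤ s ≤ min a b`, `a, b ≥ 3`;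
one orientation, `ab` clusters, `w_nn = s(s-1)`, `w_d = (s-1)²`, `w_s = s²` — the `2 × 2` plaquette:
`2, 1, 4`): sector floors `m ≤ E₀(h_C, k) + μ k`, `h_C = hubbardOpenBoxTT' s s (t/w_nn) (t'/w_d) (U/w_s)`,
give `ab · m - μ · s² · N ≤ E₀(hubbardRectTorusTT' a b t t' U, N)`. [cite: Anderson1951, eq. (2)]
[cite: ValentiStolzeHirschfeld1991, §II] -/
theorem groundEnergy_hubbardRectTorusTT'_ge_of_openBox_sq_sectors {s : ℕ} (ha : 3 ≤ a) (hb : 3 ≤ b)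
    (hs : s ≤ a) (hs' : s ≤ b) (h2s : 2 ≤ s) (t t' U μ m : ℝ)
    (hσ : ∀ k ≤ 2 * (s * s), m ≤ groundEnergy (hubbardOpenBoxTT' s s
        (t / (((s - 1) * s : ℕ) : ℝ)) (t' / (((s - 1) * (s - 1) : ℕ) : ℝ)) (U / ((s * s : ℕ) : ℝ))) k + μ * k)
    {N : ℕ} (hN : N ≤ 2 * (a * b)) :
    (a * b : ℕ) * m - μ * (s * s : ℕ) * N ≤ groundEnergy (hubbardRectTorusTT' a b t t' U) N := by
  have hw1 : (((s - 1) * s : ℕ) : ℝ) ≠ 0 := by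
    have : 0 < (s - 1) * s := Nat.mul_pos (by omega) (by omega)
    exact_mod_cast (by omega : (s - 1) * s ≠ 0)
  have hw2 : (((s - 1) * (s - 1) : ℕ) : ℝ) ≠ 0 := by
    have : 0 < (s - 1) * (s - 1) := Nat.mul_pos (by omega) (by omega)
    exact_mod_cast (by omega : (s - 1) * (s - 1) ≠ 0)
  have hw3 : ((s * s : ℕ) : ℝ) ≠ 0 := by
    have : 0 < s * s := Nat.mul_pos (by omega) (by omega)
    exact_mod_cast (by omega : s * s ≠ 0)
  have hm := posSemidef_openBox_add_smul_totalNumber_of_forall_le_groundEnergy (r := s) (c := s) _ _ _ μ m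
    (fun k hk => le_groundEnergy_add_smul_totalNumber _ μ m (by rw [card_rectSites]; exact hk) (hσ k hk))
  have h := groundEnergy_hubbardRectTorusTT'_ge_of_openBox_sq ha hb hs hs' _ _ _ μ m hm hN
  have e1 : (((s - 1) * s : ℕ) : ℝ) * (t / (((s - 1) * s : ℕ) : ℝ)) = t := by field_simp
  have e2 : (((s - 1) * (s - 1) : ℕ) : ℝ) * (t' / (((s - 1) * (s - 1) : ℕ) : ℝ)) = t' := by field_simp
  have e3 : ((s * s : ℕ) : ℝ) * (U / ((s * s : ℕ) : ℝ)) = U := by field_simp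
  rwa [e1, e2, e3] at h

end ClusterLowerBound

end Literature.MathematicalPhysics.QuantumLattice
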